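import Literature.MathematicalPhysics.QuantumLattice.FinDimSpectrum
import Literature.MathematicalPhysics.QuantumLattice.LatticeTori
import Literature.MathematicalPhysics.QuantumLattice.FermionOperators
import Literature.MathematicalPhysics.QuantumLattice.HubbardModel
import Literature.MathematicalPhysics.QuantumLattice.PairCorrelations
import Literature.Probability.LatticeModels.ThermodynamicLimit
import Literature.Probability.LatticeModels.CorrelationDecay
import HarnessLib
import HarnessLib.Audit

/-!
# Obstruction: filled stripes, not `d`-wave order, in the pure model at `U = 8`, `δ = 1/8` (numerical; Qin et al. 2020)

Barrier catalogue `Literature/Barriers/HubbardSuperconductivity/` (D-0021), entry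
`PureModelStripeCompetition`, summit `HubbardSuperconductivity` :=
`∃ U > 0, ∃ δ ∈ (0, 1/2), [every sequence of S^z = 0 sector ground states of the PURE (t' = 0)
square-lattice Hubbard model on even tori at hole doping δ has d_{x²-y²} pair-field long-range
order]`. This entry is NOT a theorem and not folklore: it transcribes the best-documented
NUMERICAL finding bearing on WHERE in `(U, δ)` the summit's matrix can hold — the multi-method
result of the Simons Collaboration that at the cuprate-regime point `U = 8`, `δ = 1/8` of the pure
model the ground state is a filled-stripe state without `d`-wave pairing order — together with the
published dissent and the published escape routes (other `(U, δ)`; `t' ≠ 0`, which leaves the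
summit's model). Its role in the catalogue is to record, with citations, which witnesses
`(U, δ)` the literature says NOT to aim at.

## Sources (as printed)

* Qin, Chung, Shi, Vitali, Hubig, Schollwöck, White, Zhang (Simons Collaboration on the
  Many-Electron Problem), *Absence of superconductivity in the pure two-dimensional Hubbard model*,
  PRX 10 (2020) 031016 (`QinEtAl2020`, held as `paper:arxiv-1910.08931`). Abstract: "We study the
  superconducting pairing correlations in the ground state of the doped Hubbard model – in its
  original form without hopping beyond nearest neighbor or other perturbing parameters – in two
  dimensions at intermediate to strong coupling and near optimal doping. … we employ two
  complementary, state-of-the-art many-body computational methods, constrained path (CP)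
  auxiliary-field quantum Monte Carlo (AFQMC) and density matrix renormalization group (DMRG)
  methods … The ground state is found to be non-superconducting in the moderate to strong coupling
  regime in the vicinity of optimal hole doping." §III (p. 7): "Absence of long-range d-wave
  pairing order at `U = 8` and `h = 1/8`"; p. 8: "At `h = 1/8` doping, the ground state has filled
  stripes with `λ = 8`"; Fig. 9 (p. 10): the pairing order parameter extrapolated in width and
  pairing field gives "`Δ_∞(0) = 0.003(6)`"; `U = 4`, `h ≃ 1/6` (pp. 10–11, Fig. 13):
  "`Δ_∞(0) = 0.006(4)`, statistically compatible with a vanishing order parameter. Of course … we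
  can not fully rule out the possibility of a finite pairing order in the ground state at `U = 4`";
  §IV (p. 11): "In the parameter regime relevant to the cuprates (`U ∼ 6-8`) we find that the pure
  Hubbard model does not have a superconducting ground state. We also find that the lack of
  superconductivity is due to a competition with stripe order, with stripes dominating. At smaller
  `U ∼ 4`, the tendency for striped ground states is much weaker. In this case, we still find a
  pairing response consistent with zero. While we cannot rule out a small nonzero pairing order
  parameter, our results place an upper bound to its [magnitude]"; §I (p. 2): "Diagrammatic Monte
  Carlo studies [Deng et al.] indicate that a BCS superconducting state of d-wave symmetry can
  emerge at weak coupling (`U/t < 4`) for doping `h ≳ 0.3`."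
* Xu, Chung, Qin, Schollwöck, White, Zhang, *Coexistence of superconductivity with partially
  filled stripes in the Hubbard model*, Science 384 (2024) eadh7691 (`XuEtAl2024`, held as
  `paper:arxiv-2303.08376`). Abstract: "we find superconductivity in both the electron- and
  hole-doped regimes of the two-dimensional Hubbard model (with next nearest neighbor hopping) …
  These stripe orders, neither filled as in the pure Hubbard model (no next nearest neighbor
  hopping) nor half-filled …"; p. 5: "with `t' = 0`, stripe and superconductivity manifest as
  competing orders. Filled stripe states are particularly stable"; p. 7: "for `t' = 0` the stripes
  were filled, and superconductivity was absent".
* Arovas–Berg–Kivelson–Raghu 2022 (`ArovasBergKivelsonRaghu2022`, `paper:arxiv-2103.12097`), §6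
  (p. 25): "For `t' = 0`, the `W = 4` leg cylinder shows significantly different tendencies. The
  most extensive studies … have been carried out primarily for the (assumed representative) value
  of `x = 1/8` … it seems that the SC correlations fall rapidly – most probably exponentially - with
  distance … suggestive of a commensurate unidirectional CDW insulating state … 'full stripes'";
  §8.1 (p. 31): "the structure of the middle part of the phase diagram, where `U/8t ∼ 1` and
  `1/12 ≲ x ≲ 1/3`, is presently unsettled … whether it actually supports a robust d-wave SC phase
  at intermediate `U` or not - is still unsettled. Under most circumstances, especially in broader
  ladders, the DMRG studies suggest that the competing tendency toward CDW order may be stronger."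
* Dissent / other methods (cited for `status`): Maier–Jarrell–Schulthess–Kent–White, PRL 95
  (2005) 237001 (`MaierEtAl2005`, `paper:arxiv-cond-mat_0504529`), abstract: DCA + QMC for the
  2D Hubbard model, "In large enough clusters, the results are independent of the cluster size and
  display a finite temperature instability to d-wave superconductivity"; Sorella, PRB 107 (2023)
  115133 (`Sorella2023`, `paper:arxiv-2101.07045`), abstract: a variational AFQMC phase diagram of
  the pure model with "a stripe phase … and … a strong coupling d-wave superconducting phase", p. 10:
  "in agreement with the claim [Qin et al.] of absence of d-wave superconductivity in the 2D
  Hubbard model, because in this work the authors refer mainly to doping `1/8`, where no BCS pairing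
  was found"; Deng–Kozik–Prokof'ev–Svistunov, EPL 110 (2015) 57001 (`DengEtAl2015`,
  `paper:arxiv-1408.2088`), p. 1: "accurate controllable results (Fig. 1) for a significant part of
  the ground-state phase diagram … `U ≤ 4` and filling `n < 0.7` where the system demonstrates
  Landau Fermi-liquid behavior … The Cooper instability then develops in the FL state … at the
  temperature `T_c` that is exponentially small".

## Lean rendering

`HasDWavePairFieldLROAt U δ` is the summit's matrix at FIXED `(U, δ)` — literally the body of
`Summits/HubbardSuperconductivity/HubbardSuperconductivity/Statement.lean` after its two
existential quantifiers (same objects: `hubbardTorus 2 L 1 U`, `IsGroundStateInSector … (N L) 0`,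
`N_L = 2⌊(1-δ)L²/2⌋`, `HasLongRangeOrder` of `torusPullback (pairFieldCorr dWaveFormFactor ψ) (2k)`),
so that the summit reads `∃ U > 0, ∃ δ ∈ Ioo 0 (1/2), HasDWavePairFieldLROAt U δ` (by `Iff.rfl`
with both files in scope; `Problems/` is not importable here). The headline
`PureModelStripeCompetition := ¬ HasDWavePairFieldLROAt 8 (1/8)` is the one case Qin et al. carry
to the thermodynamic limit, registered as an OPEN CONJECTURE (no proof exists in either direction;
see `status` and the next section). Nothing is proved in this file beyond unfolding lemmas.

## Status of the two named claims (verdict clean-up 2026-08-15)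

Both `def … : Prop` claims of this file — the headline `PureModelStripeCompetition` and its range
form `PureModelStripeCompetitionRange` — were seated as dischargeable named facts and returned by
their tenured prove-seats with the verdict OPEN PROBLEM, re-verified here on the pages: the source
POSES them as the conclusion of a computation, not of a proof — "A quadratic fit is then performed,
which yields a value `Δ_∞(0) = 0.003(6)` … We thus conclude that there is no long-range SC pairing
in this system in the TDL" (arXiv:1910.08931 p. 9, §III.B with Fig. 9 on p. 10; methods: "DMRG
calculations … on up to width-6 cylinders", "AFQMC computations … relying on total energy
calculations", §IV p. 11), the `U`-dependence resting on "16 × 4 systems, varying only `U`"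
(Fig. 11, p. 10); and the standing review rates exactly this question open — "the structure of the
middle part of the phase diagram, where `U/8t ∼ 1` and `1/12 ≲ x ≲ 1/3`, is presently unsettled …
whether it actually supports a robust d-wave SC phase at intermediate `U` or not - is still
unsettled" (arXiv:2103.12097 §8.1 p. 31), listed under "9. Important Open Questions: Is the Hubbard
model a high temperature SC? … it still remains uncertain whether - and if so under what
circumstances" (ibid. p. 33). A Lean discharge of either claim would be a rigorous proof of the
ABSENCE of `d_{x²-y²}` pair-field long-range order in two-dimensional Hubbard ground states at
`(U, δ) = (8, 1/8)` (resp. for all `U ∈ [6, 8]` at `δ = 1/8`), and a Lean refutation would prove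
the summit `HubbardSuperconductivity` outright (`pureModelStripeCompetition_or_summitShape`,
`pureModelStripeCompetitionRange_or_summitShape` in the companion
`PureModelStripeCompetitionProofs.lean`): neither is a formalization exercise. Treatment
(MARK-OPEN; CONVENTIONS §4: open conjectures are `def … : Prop`, never asserted): both docstrings
now begin `OPEN CONJECTURE —`, cite where the statement is posed and carry `[status: open]`; there
is deliberately no `PureModelStripeCompetition_holds` / `PureModelStripeCompetitionRange_holds`,
and users take them as explicit hypotheses `(h : …)`. Both NAMES ARE KEPT (not renamed
`…Conjecture`): `PureModelStripeCompetition` is the body of the route item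
`StripePointExclusion` of the Theses file `PlateauExclusion.lean` of this summit (namespace
`Summit.HubbardSuperconductivity.HubbardSuperconductivity.Theses.PlateauExclusion`) and is used
throughout `PureModelStripeCompetitionProofs.lean` (`pureModelStripeCompetition_iff_exists`,
`pureModelStripeCompetition_or_summitShape`); `PureModelStripeCompetitionRange` is used by
`PureModelStripeCompetitionRange.headline` (here) and by `pureModelStripeCompetitionRange_iff`,
`pureModelStripeCompetitionRange_iff_exists`, `not_pureModelStripeCompetitionRange_iff`,
`pureModelStripeCompetitionRange_or_summitShape`, `PureModelStripeCompetitionRange.exists_headline`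
(companion file). Both Lean statements are unchanged; the barrier block of the headline
(`technique_class` … `status`) is unchanged in content.

## Mathlib / tree search

Tree: the summit's ingredients (above), `Literature/MathematicalPhysics/QuantumLattice/DWaveSource.lean`
(order parameter with a pairing source field, the object Qin et al. extrapolate),
`Barriers/HubbardSuperconductivity/LROForcesLowLyingStates.lean` (LRO ⇒ low-lying states, the
rigorous half of "LRO ⇒ nonzero order parameter"); nothing on stripes
(`lean search -i 'stripe'`: no hits). Mathlib: n/a.

## References

* M. Qin et al., Phys. Rev. X 10 (2020) 031016, §§I–IV, Figs. 9, 11–13.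
* H. Xu et al., Science 384 (2024) eadh7691, abstract, pp. 5, 7 of arXiv:2303.08376.
* D. Arovas, E. Berg, S. Kivelson, S. Raghu, Annu. Rev. CMP 13 (2022) 239, §6 p. 25, §8.1 p. 31,
  §9 p. 33 (pages of arXiv:2103.12097).
* T. Maier et al., PRL 95 (2005) 237001; S. Sorella, PRB 107 (2023) 115133; Y. Deng et al.,
  EPL 110 (2015) 57001; S. Raghu, S. Kivelson, D. Scalapino, PRB 81 (2010) 224505, §III.B.
-/

noncomputable section

namespace Literature.Barriers.HubbardSuperconductivity

open Matrix Finset Filter Literature.Probability.LatticeModels Literature.MathematicalPhysics.QuantumLattice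
open scoped ComplexOrder Topology

/-- **The summit's matrix at fixed parameters.** `HasDWavePairFieldLROAt U δ`: for the pure
(`t = 1`, `t' = 0`) Hubbard model `hubbardTorus 2 L 1 U` on the square tori of even side with
`N_L = 2⌊(1 - δ)L²/2⌋` electrons in the `S^z = 0` sector, EVERY sequence of normalised sector
ground states has `d_{x²-y²}` pair-field long-range order along even sides — word for word the
body of `Literature.Hubbard.DWaveSuperconductivityHubbard` (the summit `HubbardSuperconductivity` is
`∃ U > 0, ∃ δ ∈ Ioo 0 (1/2), HasDWavePairFieldLROAt U δ`).
[cite: ArovasBergKivelsonRaghu2022, §1 item 1) and §9] -/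
def HasDWavePairFieldLROAt (U δ : ℝ) : Prop :=
  ∀ (N : ℕ → ℕ) (ψ : ∀ L, Fock (Orb (FermionTorus 2 L))),
    (∀ L, Even L → N L = 2 * ⌊(1 - δ) * (L : ℝ) ^ 2 / 2⌋₊ ∧ star (ψ L) ⬝ᵥ ψ L = 1 ∧
        IsGroundStateInSector (hubbardTorus 2 L 1 U) (N L) 0 (ψ L)) →
      HasLongRangeOrder (fun k => halfOpenBox 2 (2 * k))
        (fun k => torusPullback (pairFieldCorr dWaveFormFactor ψ) (2 * k))

/-- **The cuprate-regime witnesses** — the class of attacks on the summit this entry concerns: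
instantiating `∃ U, ∃ δ` at `U/t ∈ [6, 8]` ("the parameter regime relevant to the cuprates
(`U ∼ 6-8`)") and `δ = 1/8` ("the vicinity of optimal hole doping"), the filled-stripe regime of the
pure model. [cite: QinEtAl2020, §IV p. 11 and abstract] -/
def IsCuprateRegimeWitness (U δ : ℝ) : Prop :=
  U ∈ Set.Icc (6 : ℝ) 8 ∧ δ = 1 / 8

/-- OPEN CONJECTURE — **OBSTRUCTION `PureModelStripeCompetition`: no `d_{x²-y²}` pair-field
long-range order in the pure two-dimensional Hubbard model at `U = 8`, `δ = 1/8`, `t' = 0`**, POSED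
(as the conclusion of a DMRG + constrained-path AFQMC computation, NOT as a theorem) in M. Qin,
C.-M. Chung, H. Shi, E. Vitali, C. Hubig, U. Schollwöck, S. R. White, S. Zhang, *Absence of
superconductivity in the pure two-dimensional Hubbard model*, Phys. Rev. X 10 (2020) 031016, §III.B
(arXiv:1910.08931 p. 9, Fig. 9 p. 10) and §IV (p. 11)
[cite: QinEtAl2020, §III.B p. 9 (Fig. 9) and §IV p. 11] [status: open]: "A quadratic fit is then
performed, which yields a value `Δ_∞(0) = 0.003(6)` … We thus conclude that there is no long-range
SC pairing in this system in the TDL" (p. 9); "In the parameter regime relevant to the cuprates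
(`U ∼ 6-8`) we find that the pure Hubbard model does not have a superconducting ground state. We
also find that the lack of superconductivity is due to a competition with stripe order, with
stripes dominating" (§IV p. 11). In Lean: at `U = 8`, hole doping `δ = 1/8`, `t' = 0`, the summit's
matrix fails — NOT every sequence of normalised `S^z = 0` sector ground states of the pure
square-lattice Hubbard model on the even tori has `d_{x²-y²}` pair-field long-range order (the
ground state "has filled stripes with `λ = 8`", p. 8). Proved nowhere, in either direction: the
source's evidence is numerical (width-`≤ 6` cylinders, cells up to `32 × 8`, extrapolations in
width and pairing field), and the standing review rates the question open — "whether it actually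
supports a robust d-wave SC phase at intermediate `U` or not - is still unsettled"
[cite: ArovasBergKivelsonRaghu2022, §8.1 p. 31 and §9 p. 33]. A discharge
`PureModelStripeCompetition_holds` would be a rigorous proof of absence of `d`-wave pair-field LRO
in 2D Hubbard ground states at `(8, 1/8)`; a refutation would prove the summit
(`pureModelStripeCompetition_or_summitShape`, companion file). Hence this is a registered OPEN
STATEMENT (CONVENTIONS §4), not dischargeable named-fact debt: there is deliberately no `_holds`;
use it only as an explicit hypothesis `(h : PureModelStripeCompetition)`. Name kept (not renamed
`…Conjecture`): users `Theses.PlateauExclusion.StripePointExclusion` and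
`PureModelStripeCompetitionProofs.lean`; verdict of the tenured prove-seat (open problem)
re-verified 2026-08-15 against arXiv:1910.08931 pp. 8–11 and arXiv:2103.12097 pp. 31, 33;
statement unchanged.

technique_class: cuprate-regime-witnesses stripe-regime-approaches pure-model-at-U≈8t-δ=⅛-t'=0 finite-cluster-numerics-as-certificate DMRG CP-AFQMC DCA
blocks: proving `HubbardSuperconductivity` through a witness in the class `IsCuprateRegimeWitness` — `(U, δ) = (8, 1/8)` carried to the thermodynamic limit, "`U ∼ 6-8`" in "the vicinity of optimal hole doping" as printed — i.e. establishing `HasDWavePairFieldLROAt U (1/8)` for the PURE (`t' = 0`) model there by any method (strong-correlation or stripe-based mechanisms aimed at the cuprate regime, or numerics used as a certificate): "The ground state is found to be non-superconducting in the moderate to strong coupling regime in the vicinity of optimal hole doping" [cite: QinEtAl2020, abstract]; "In the parameter regime relevant to the cuprates (`U ∼ 6-8`) we find that the pure Hubbard model does not have a superconducting ground state" [cite: QinEtAl2020, §IV p. 11]; equally the natural strengthening "a dome of d-wave superconductivity throughout a range of doping" of the pure model at intermediate `U` [cite: ArovasBergKivelsonRaghu2022, §1 item 1)] is obstructed at its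 centre `δ = 1/8`.
because: at `U = 8`, `h = 1/8` "the ground state has filled stripes with `λ = 8`" and the width- and field-extrapolated pairing order parameter is "`Δ_∞(0) = 0.003(6)`", with d-wave pair–pair correlations decaying on width-4 and width-6 cylinders and in a `32 × 6` periodic cell [cite: QinEtAl2020, §III pp. 7–10, Figs. 6–9]; "the lack of superconductivity is due to a competition with stripe order, with stripes dominating" [cite: QinEtAl2020, §IV p. 11]; "with `t' = 0`, stripe and superconductivity manifest as competing orders. Filled stripe states are particularly stable" and "for `t' = 0` the stripes were filled, and superconductivity was absent" [cite: XuEtAl2024, pp. 5 and 7]; on `t' = 0` four-leg cylinders at `x = 1/8` "the SC correlations fall rapidly – most probably exponentially - with distance … 'full stripes'" [cite: ArovasBergKivelsonRaghu2022, §6 p. 25].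
evasions_known: (i) other witnesses `(U, δ)` of the SAME pure model, as the summit's `∃ U > 0, ∃ δ ∈ (0, 1/2)` allows: weak coupling and larger doping — "a BCS superconducting state of d-wave symmetry can emerge at weak coupling (`U/t < 4`) for doping `h ≳ 0.3`" [cite: QinEtAl2020, §I p. 2], from bold diagrammatic Monte Carlo plus BCS for `U ≤ 4`, `n < 0.7` (emergent BCS regime of a Fermi liquid, `T_c` exponentially small) [cite: DengEtAl2015, p. 1 and Fig. 1], and the weak-coupling RG gives `d_{x²-y²}` for `0.6 < n < 1` at `t' = 0` [cite: RaghuKivelsonScalapino2010, §III.B p. 6] — there the order parameter is exponentially small in `t²/U²` (`PerturbativeInvisibilityOfPairing.lean`, `WeakCouplingCeiling.lean`); at `U = 4`, `h ≃ 1/6`: "`Δ_∞(0) = 0.006(4)`, statistically compatible with a vanishing order parameter … we can not fully rule out the possibility of a finite pairing order" [cite: QinEtAl2020, §III pp. 10–11]; a variational AFQMC phase diagram of the pure model contains "a strong coupling d-wave superconducting phase" in a doping window away from `1/8`, "in agreement with the claim of absence of d-wave superconductivity … because … the authors refer mainly to doping `1/8`" [cite: Sorella2023, abstract and p. 10]; (ii)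 leaving the summit's model: with next-nearest-neighbour hopping `t' ≠ 0` superconductivity coexists with partially filled stripes on both electron- and hole-doped sides [cite: XuEtAl2024, abstract].
scope_caveats: NOTHING in this entry is a theorem: the headline transcribes a NUMERICAL finding of two approximate methods (DMRG on cylinders of width `≤ 6`; constrained-path AFQMC, whose constraint bias is controlled by cross-checks against DMRG, not by bounds), with extrapolations in cylinder width and in the applied pairing field [cite: QinEtAl2020, §II–§III]; the printed scope is "`U ∼ 6-8`", "vicinity of optimal hole doping" — only `U = 8`, `δ = 1/8` (the case carried to the thermodynamic limit, Fig. 9) is transcribed in Lean, the `U`-dependence resting on `16 × 4` cells (Fig. 11); the step from "vanishing extrapolated pairing order parameter / exponentially decaying pair correlations" to the summit's exact negation "some sequence of normalised `S^z = 0` torus ground states at `N_L = 2⌊(7/8)L²/2⌋` lacks pair-field LRO" uses the standard implication LRO ⇒ nonzero order parameter under an infinitesimal pairing field (Koma–Tasaki; `LROForcesLowLyingStates.lean` records its finite-volume half), which is assumed, not proved, in this transcription; even tori vs. the cylinders/rectangular cells of the computation is a further untranscribed finite-geometry gap; ABKR rate the whole intermediate-`U` region `1/12 ≲ x ≲ 1/3`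 "presently unsettled" [cite: ArovasBergKivelsonRaghu2022, §8.1 p. 31].
status: contested (numerical consensus for absence at `t' = 0`, `U ∼ 6-8`, `δ ≈ 1/8` [cite: QinEtAl2020, §IV] [cite: XuEtAl2024, p. 7], reviewed as "unsettled … the competing tendency toward CDW order may be stronger" [cite: ArovasBergKivelsonRaghu2022, §8.1 p. 31]; dissenting or complementary affirmative results for the pure model by other methods or at other parameters: DCA "finite temperature instability to d-wave superconductivity" [cite: MaierEtAl2005, abstract], variational AFQMC strong-coupling d-wave phase away from `1/8` [cite: Sorella2023, abstract and p. 10], weak-coupling emergent BCS regime [cite: DengEtAl2015, p. 1]; no theorem either way — registered here as an OPEN CONJECTURE, `[status: open]`, "presently unsettled" [cite: ArovasBergKivelsonRaghu2022, §8.1 p. 31])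
[cite: QinEtAl2020, abstract, §III pp. 7–10 (Fig. 9) and §IV p. 11] -/
@[conjecture] def PureModelStripeCompetition : Prop :=
  ¬ HasDWavePairFieldLROAt 8 (1 / 8)

/-! ### API (unfolding only; nothing substantive is provable here) -/

/-- Unfolding lemma. [cite: QinEtAl2020, §IV p. 11] -/
theorem pureModelStripeCompetition_iff :
    PureModelStripeCompetition ↔ ¬ HasDWavePairFieldLROAt 8 (1 / 8) :=
  Iff.rfl

/-- `(8, 1/8)` is a cuprate-regime witness in the sense of `IsCuprateRegimeWitness`.
[cite: QinEtAl2020, §IV p. 11] -/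
theorem isCuprateRegimeWitness_eight_eighth : IsCuprateRegimeWitness 8 (1 / 8) :=
  ⟨⟨by norm_num, le_rfl⟩, rfl⟩

/-- OPEN CONJECTURE — **the printed claim in its quantified form over the witness class
("`U ∼ 6-8`", `δ = 1/8`): every cuprate-regime witness fails**, i.e.
`∀ U δ, IsCuprateRegimeWitness U δ → ¬ HasDWavePairFieldLROAt U δ` (equivalently
`∀ U ∈ [6, 8], ¬ HasDWavePairFieldLROAt U (1/8)`, `pureModelStripeCompetitionRange_iff` in the
companion file), POSED (as a numerical conclusion, NOT as a theorem) in Qin et al., Phys. Rev. X 10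
(2020) 031016, §IV (arXiv:1910.08931 p. 11): "In the parameter regime relevant to the cuprates
(`U ∼ 6-8`) we find that the pure Hubbard model does not have a superconducting ground state", the
`U`-dependence resting on §III.D, Fig. 11 (p. 10): "the pairing order parameter for `U = 4, 6` and
`8` at `1/8` doping … on a `16 × 4` system" [cite: QinEtAl2020, §IV p. 11 and §III.D Fig. 11]
[status: open]. STRONGER than the headline (only `U = 8` is carried to the thermodynamic limit in
the source, Fig. 9; `PureModelStripeCompetitionRange.headline`) and likewise proved nowhere in
either direction, the whole intermediate-coupling region being "presently unsettled … still
unsettled" [cite: ArovasBergKivelsonRaghu2022, §8.1 p. 31]. A discharge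
`PureModelStripeCompetitionRange_holds` would be a rigorous proof of absence of `d_{x²-y²}`
pair-field LRO in 2D Hubbard ground states for every `U ∈ [6, 8]` at `δ = 1/8`; a refutation would
prove the summit (`pureModelStripeCompetitionRange_or_summitShape`, companion file). Registered OPEN
STATEMENT (CONVENTIONS §4), not dischargeable named-fact debt: there is deliberately no `_holds`;
use it only as an explicit hypothesis `(h : PureModelStripeCompetitionRange)`. Name kept (not
renamed `…Conjecture`): users `PureModelStripeCompetitionRange.headline` (below) and
`pureModelStripeCompetitionRange_iff`, `pureModelStripeCompetitionRange_iff_exists`,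
`not_pureModelStripeCompetitionRange_iff`, `pureModelStripeCompetitionRange_or_summitShape`,
`PureModelStripeCompetitionRange.exists_headline` (`PureModelStripeCompetitionProofs.lean`); verdict
of the tenured prove-seat (open problem) re-verified 2026-08-15 against arXiv:1910.08931 pp. 10–11;
statement unchanged. -/
@[conjecture] def PureModelStripeCompetitionRange : Prop :=
  ∀ U δ : ℝ, IsCuprateRegimeWitness U δ → ¬ HasDWavePairFieldLROAt U δ

/-- The range form implies the headline. [folklore] -/
theorem PureModelStripeCompetitionRange.headline (h : PureModelStripeCompetitionRange) :
    PureModelStripeCompetition :=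
  h 8 (1 / 8) isCuprateRegimeWitness_eight_eighth

/-- Contrapositive reading for route planners: IF the summit's matrix holds at `(8, 1/8)` then
the numerical finding transcribed here is wrong (the two are each other's negation). [folklore] -/
theorem not_pureModelStripeCompetition_iff :
    ¬ PureModelStripeCompetition ↔ ¬¬ HasDWavePairFieldLROAt 8 (1 / 8) :=
  Iff.rfl

end Literature.Barriers.HubbardSuperconductivity

end
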